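import Mathlib
import Summits.Ventures.PercRepro2.K5TypedK3Marks
import Summits.Ventures.PercRepro2.TwoMarkHubK5

/-!
# The hub certificate from `K₅` (blind cell PercRepro2, mine-2 g40, 2026-08-28;
`proofs/MINE2-HUBK5.md` §3, row M2-85 — part II: the certificate is not decided, it is `K₅`)

For each of the ten multisets of `Q`-patterns (`n_L` copies with `x ~ a₁`, `n_H` with `x ~ a₂`,
`n_L + n_H ≤ 3`) the gluing theorem on `K₅` (`six_mul_typedCount_K5`, `TwoMarkHubK5.lean`) is
evaluated: the placements of the two boundary edges realise every arrangement of the multiset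
once (`C_perm`) or are killed by `Q` (`C_eq_zero_of_J`), so six times the typed count of the
instance is `n₀!·n_L!·n_H!` times the gadget sum, and the typed count is nonnegative by typer-1's
all-marked base `K5.typedCount_K3_nonneg` (`C_nonneg_OOO` … `C_nonneg_LHH`).  Hence
**`C_nonneg`**: for every typing of the seven slots and every transitive pattern triple the
gadget sum is nonnegative — the certificate of the three hubs, with nothing decided.  Own code;
standard axioms.
-/

namespace Summit.Ventures.PercRepro2

open UnionCluster

namespace CovForm

namespace THub

open OneTyped Untouched OStar K5 TypedFactor SepThree TypedRed

/-! ## The certificate: every gadget sum is a positive multiple of a typed count on `K₅` -/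

section Cert

/-- The typed count of the instance is nonnegative (typer-1's all-marked `K₅` base). -/
lemma tc_nonneg (h : HubType) (t : Fin 7 → ℕ) (nL nH : ℕ) :
    (0 : ℚ) ≤ typedCount (F5 h t nL nH) (fun _ => false) (τ5 h t nL nH)
      (K3 ends5 0 1 2 3 4 : Config (Fin 10) → Config (Fin 10) → Config (Fin 10) → ℚ) :=
  typedCount_K3_nonneg _ _ _

/-- `(O, O, O)`: the gadget sum from the typed count with `n_L = 0`, `n_H = 0`. -/
lemma C_nonneg_OOO (h : HubType) (t : Fin 7 → ℕ) :
    0 ≤ C h t (false, false, false) (false, false, false) (false, false, false) := by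
  have key := six_mul_typedCount_K5 (R := ℚ) h t 0 0
  have hpos := tc_nonneg h t 0 0
  simp only [plc, List.map_cons, List.map_nil, List.sum_cons, List.sum_nil, pp, add_zero] at key
  have hq : (0 : ℚ) ≤ ((C h t (false, false, false) (false, false, false) (false, false, false) : ℤ) : ℚ) := by linarith
  exact_mod_cast hq

/-- `(L, O, O)`: the gadget sum from the typed count with `n_L = 1`, `n_H = 0`. -/
lemma C_nonneg_LOO (h : HubType) (t : Fin 7 → ℕ) :
    0 ≤ C h t (true, false, false) (false, false, false) (false, false, false) := by
  have key := six_mul_typedCount_K5 (R := ℚ) h t 1 0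
  have hpos := tc_nonneg h t 1 0
  simp only [plc, List.map_cons, List.map_nil, List.sum_cons, List.sum_nil, pp, add_zero] at key
  rw [← (C_perm h t (true, false, false) (false, false, false) (false, false, false)).2.2.1,
    ← (C_perm h t (true, false, false) (false, false, false) (false, false, false)).1] at key
  have hq : (0 : ℚ) ≤ ((C h t (true, false, false) (false, false, false) (false, false, false) : ℤ) : ℚ) := by linarith
  exact_mod_cast hq

/-- `(H, O, O)`: the gadget sum from the typed count with `n_L = 0`, `n_H = 1`. -/
lemma C_nonneg_HOO (h : HubType) (t : Fin 7 → ℕ) :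
    0 ≤ C h t (false, true, false) (false, false, false) (false, false, false) := by
  have key := six_mul_typedCount_K5 (R := ℚ) h t 0 1
  have hpos := tc_nonneg h t 0 1
  simp only [plc, List.map_cons, List.map_nil, List.sum_cons, List.sum_nil, pp, add_zero] at key
  rw [← (C_perm h t (false, true, false) (false, false, false) (false, false, false)).2.2.1,
    ← (C_perm h t (false, true, false) (false, false, false) (false, false, false)).1] at key
  have hq : (0 : ℚ) ≤ ((C h t (false, true, false) (false, false, false) (false, false, false) : ℤ) : ℚ) := by linarith
  exact_mod_cast hq

/-- `(L, L, O)`: the gadget sum from the typed count with `n_L = 2`, `n_H = 0`. -/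
lemma C_nonneg_LLO (h : HubType) (t : Fin 7 → ℕ) :
    0 ≤ C h t (true, false, false) (true, false, false) (false, false, false) := by
  have key := six_mul_typedCount_K5 (R := ℚ) h t 2 0
  have hpos := tc_nonneg h t 2 0
  simp only [plc, List.map_cons, List.map_nil, List.sum_cons, List.sum_nil, pp, add_zero] at key
  rw [← (C_perm h t (true, false, false) (true, false, false) (false, false, false)).2.2.2.1,
    ← (C_perm h t (true, false, false) (true, false, false) (false, false, false)).2.1] at key
  have hq : (0 : ℚ) ≤ ((C h t (true, false, false) (true, false, false) (false, false, false) : ℤ) : ℚ) := by linarith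
  exact_mod_cast hq

/-- `(H, H, O)`: the gadget sum from the typed count with `n_L = 0`, `n_H = 2`. -/
lemma C_nonneg_HHO (h : HubType) (t : Fin 7 → ℕ) :
    0 ≤ C h t (false, true, false) (false, true, false) (false, false, false) := by
  have key := six_mul_typedCount_K5 (R := ℚ) h t 0 2
  have hpos := tc_nonneg h t 0 2
  simp only [plc, List.map_cons, List.map_nil, List.sum_cons, List.sum_nil, pp, add_zero] at key
  rw [← (C_perm h t (false, true, false) (false, true, false) (false, false, false)).2.2.2.1,
    ← (C_perm h t (false, true, false) (false, true, false) (false, false, false)).2.1] at key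
  have hq : (0 : ℚ) ≤ ((C h t (false, true, false) (false, true, false) (false, false, false) : ℤ) : ℚ) := by linarith
  exact_mod_cast hq

/-- `(L, H, O)`: the gadget sum from the typed count with `n_L = 1`, `n_H = 1`. -/
lemma C_nonneg_LHO (h : HubType) (t : Fin 7 → ℕ) :
    0 ≤ C h t (true, false, false) (false, true, false) (false, false, false) := by
  have key := six_mul_typedCount_K5 (R := ℚ) h t 1 1
  have hpos := tc_nonneg h t 1 1
  simp only [plc, List.map_cons, List.map_nil, List.sum_cons, List.sum_nil, pp, add_zero] at key
  rw [show C h t (false, false, false) (false, false, false) (true, true, true) = 0 from C_eq_zero_of_J h t (Or.inr (Or.inr rfl)),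
    ← (C_perm h t (true, false, false) (false, true, false) (false, false, false)).2.2.2.2,
    ← (C_perm h t (true, false, false) (false, true, false) (false, false, false)).2.2.1,
    ← (C_perm h t (true, false, false) (false, true, false) (false, false, false)).2.2.2.1,
    show C h t (false, false, false) (true, true, true) (false, false, false) = 0 from C_eq_zero_of_J h t (Or.inr (Or.inl rfl)),
    ← (C_perm h t (true, false, false) (false, true, false) (false, false, false)).1,
    ← (C_perm h t (true, false, false) (false, true, false) (false, false, false)).2.1,
    show C h t (true, true, true) (false, false, false) (false, false, false) = 0 from C_eq_zero_of_J h t (Or.inl rfl)] at key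
  simp only [Int.cast_zero, zero_add, add_zero] at key
  have hq : (0 : ℚ) ≤ ((C h t (true, false, false) (false, true, false) (false, false, false) : ℤ) : ℚ) := by linarith
  exact_mod_cast hq

/-- `(L, L, L)`: the gadget sum from the typed count with `n_L = 3`, `n_H = 0`. -/
lemma C_nonneg_LLL (h : HubType) (t : Fin 7 → ℕ) :
    0 ≤ C h t (true, false, false) (true, false, false) (true, false, false) := by
  have key := six_mul_typedCount_K5 (R := ℚ) h t 3 0
  have hpos := tc_nonneg h t 3 0
  simp only [plc, List.map_cons, List.map_nil, List.sum_cons, List.sum_nil, pp, add_zero] at key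
  have hq : (0 : ℚ) ≤ ((C h t (true, false, false) (true, false, false) (true, false, false) : ℤ) : ℚ) := by linarith
  exact_mod_cast hq

/-- `(H, H, H)`: the gadget sum from the typed count with `n_L = 0`, `n_H = 3`. -/
lemma C_nonneg_HHH (h : HubType) (t : Fin 7 → ℕ) :
    0 ≤ C h t (false, true, false) (false, true, false) (false, true, false) := by
  have key := six_mul_typedCount_K5 (R := ℚ) h t 0 3
  have hpos := tc_nonneg h t 0 3
  simp only [plc, List.map_cons, List.map_nil, List.sum_cons, List.sum_nil, pp, add_zero] at key
  have hq : (0 : ℚ) ≤ ((C h t (false, true, false) (false, true, false) (false, true, false) : ℤ) : ℚ) := by linarith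
  exact_mod_cast hq

/-- `(L, L, H)`: the gadget sum from the typed count with `n_L = 2`, `n_H = 1`. -/
lemma C_nonneg_LLH (h : HubType) (t : Fin 7 → ℕ) :
    0 ≤ C h t (true, false, false) (true, false, false) (false, true, false) := by
  have key := six_mul_typedCount_K5 (R := ℚ) h t 2 1
  have hpos := tc_nonneg h t 2 1
  simp only [plc, List.map_cons, List.map_nil, List.sum_cons, List.sum_nil, pp, add_zero] at key
  rw [show C h t (false, false, false) (true, false, false) (true, true, true) = 0 from C_eq_zero_of_J h t (Or.inr (Or.inr rfl)),
    show C h t (false, false, false) (true, true, true) (true, false, false) = 0 from C_eq_zero_of_J h t (Or.inr (Or.inl rfl)),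
    ← (C_perm h t (true, false, false) (true, false, false) (false, true, false)).2.2.2.1,
    show C h t (true, false, false) (false, false, false) (true, true, true) = 0 from C_eq_zero_of_J h t (Or.inr (Or.inr rfl)),
    ← (C_perm h t (true, false, false) (true, false, false) (false, true, false)).2.1,
    show C h t (true, true, true) (false, false, false) (true, false, false) = 0 from C_eq_zero_of_J h t (Or.inl rfl),
    show C h t (true, false, false) (true, true, true) (false, false, false) = 0 from C_eq_zero_of_J h t (Or.inr (Or.inl rfl)),
    show C h t (true, true, true) (true, false, false) (false, false, false) = 0 from C_eq_zero_of_J h t (Or.inl rfl)] at key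
  simp only [Int.cast_zero, zero_add, add_zero] at key
  have hq : (0 : ℚ) ≤ ((C h t (true, false, false) (true, false, false) (false, true, false) : ℤ) : ℚ) := by linarith
  exact_mod_cast hq

/-- `(L, H, H)`: the gadget sum from the typed count with `n_L = 1`, `n_H = 2`. -/
lemma C_nonneg_LHH (h : HubType) (t : Fin 7 → ℕ) :
    0 ≤ C h t (true, false, false) (false, true, false) (false, true, false) := by
  have key := six_mul_typedCount_K5 (R := ℚ) h t 1 2
  have hpos := tc_nonneg h t 1 2
  simp only [plc, List.map_cons, List.map_nil, List.sum_cons, List.sum_nil, pp, add_zero] at key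
  rw [show C h t (false, false, false) (false, true, false) (true, true, true) = 0 from C_eq_zero_of_J h t (Or.inr (Or.inr rfl)),
    show C h t (false, true, false) (false, false, false) (true, true, true) = 0 from C_eq_zero_of_J h t (Or.inr (Or.inr rfl)),
    ← (C_perm h t (true, false, false) (false, true, false) (false, true, false)).2.2.1,
    show C h t (false, false, false) (true, true, true) (false, true, false) = 0 from C_eq_zero_of_J h t (Or.inr (Or.inl rfl)),
    ← (C_perm h t (true, false, false) (false, true, false) (false, true, false)).1,
    show C h t (false, true, false) (true, true, true) (false, false, false) = 0 from C_eq_zero_of_J h t (Or.inr (Or.inl rfl)),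
    show C h t (true, true, true) (false, false, false) (false, true, false) = 0 from C_eq_zero_of_J h t (Or.inl rfl),
    show C h t (true, true, true) (false, true, false) (false, false, false) = 0 from C_eq_zero_of_J h t (Or.inl rfl)] at key
  simp only [Int.cast_zero, zero_add, add_zero] at key
  have hq : (0 : ℚ) ≤ ((C h t (true, false, false) (false, true, false) (false, true, false) : ℤ) : ℚ) := by linarith
  exact_mod_cast hq

/-- **THE CERTIFICATE FROM `K₅`**: for every typing of the seven slots and every transitive
pattern triple the gadget sum is nonnegative — a pattern joining the roots gives `0`, and every
arrangement of `Q`-patterns is a positive multiple of a typed count on `K₅`. -/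
theorem C_nonneg (h : HubType) (t : Fin 7 → ℕ) {P₁ P₂ P₃ : Pat3} (v₁ : valid P₁ = true)
    (v₂ : valid P₂ = true) (v₃ : valid P₃ = true) : 0 ≤ C h t P₁ P₂ P₃ := by
  obtain ⟨l₁, h₁, j₁⟩ := P₁
  obtain ⟨l₂, h₂, j₂⟩ := P₂
  obtain ⟨l₃, h₃, j₃⟩ := P₃
  cases j₁
  · cases j₂
    · cases j₃
      · cases l₁ <;> cases h₁ <;> cases l₂ <;> cases h₂ <;> cases l₃ <;> cases h₃
        case false.false.false.false.false.false.false.false.false => exact C_nonneg_OOO h t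
        case false.false.false.false.false.false.false.false.true => rw [C_swap23 h t, C_swap12 h t]; exact C_nonneg_HOO h t
        case false.false.false.false.false.false.false.true.false => rw [C_swap23 h t, C_swap12 h t]; exact C_nonneg_LOO h t
        case false.false.false.false.false.false.false.true.true => exact absurd v₃ (by decide)
        case false.false.false.false.false.false.true.false.false => rw [C_swap12 h t]; exact C_nonneg_HOO h t
        case false.false.false.false.false.false.true.false.true => rw [C_swap12 h t, C_swap23 h t]; exact C_nonneg_HHO h t
        case false.false.false.false.false.false.true.true.false => rw [C_swap12 h t, C_swap23 h t, C_swap12 h t]; exact C_nonneg_LHO h t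
        case false.false.false.false.false.false.true.true.true => exact absurd v₃ (by decide)
        case false.false.false.false.false.true.false.false.false => rw [C_swap12 h t]; exact C_nonneg_LOO h t
        case false.false.false.false.false.true.false.false.true => rw [C_swap12 h t, C_swap23 h t]; exact C_nonneg_LHO h t
        case false.false.false.false.false.true.false.true.false => rw [C_swap12 h t, C_swap23 h t]; exact C_nonneg_LLO h t
        case false.false.false.false.false.true.false.true.true => exact absurd v₃ (by decide)
        case false.false.false.false.false.true.true.false.false => exact absurd v₂ (by decide)
        case false.false.false.false.false.true.true.false.true => exact absurd v₂ (by decide)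
        case false.false.false.false.false.true.true.true.false => exact absurd v₂ (by decide)
        case false.false.false.false.false.true.true.true.true => exact absurd v₂ (by decide)
        case false.false.false.false.true.false.false.false.false => exact C_nonneg_HOO h t
        case false.false.false.false.true.false.false.false.true => rw [C_swap23 h t]; exact C_nonneg_HHO h t
        case false.false.false.false.true.false.false.true.false => rw [C_swap23 h t, C_swap12 h t]; exact C_nonneg_LHO h t
        case false.false.false.false.true.false.false.true.true => exact absurd v₃ (by decide)
        case false.false.false.false.true.false.true.false.false => exact C_nonneg_HHO h t
        case false.false.false.false.true.false.true.false.true => exact C_nonneg_HHH h t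
        case false.false.false.false.true.false.true.true.false => rw [C_swap23 h t, C_swap12 h t]; exact C_nonneg_LHH h t
        case false.false.false.false.true.false.true.true.true => exact absurd v₃ (by decide)
        case false.false.false.false.true.true.false.false.false => rw [C_swap12 h t]; exact C_nonneg_LHO h t
        case false.false.false.false.true.true.false.false.true => rw [C_swap12 h t]; exact C_nonneg_LHH h t
        case false.false.false.false.true.true.false.true.false => rw [C_swap12 h t, C_swap23 h t]; exact C_nonneg_LLH h t
        case false.false.false.false.true.true.false.true.true => exact absurd v₃ (by decide)
        case false.false.false.false.true.true.true.false.false => exact absurd v₂ (by decide)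
        case false.false.false.false.true.true.true.false.true => exact absurd v₂ (by decide)
        case false.false.false.false.true.true.true.true.false => exact absurd v₂ (by decide)
        case false.false.false.false.true.true.true.true.true => exact absurd v₂ (by decide)
        case false.false.false.true.false.false.false.false.false => exact C_nonneg_LOO h t
        case false.false.false.true.false.false.false.false.true => rw [C_swap23 h t]; exact C_nonneg_LHO h t
        case false.false.false.true.false.false.false.true.false => rw [C_swap23 h t]; exact C_nonneg_LLO h t
        case false.false.false.true.false.false.false.true.true => exact absurd v₃ (by decide)
        case false.false.false.true.false.false.true.false.false => exact C_nonneg_LHO h t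
        case false.false.false.true.false.false.true.false.true => exact C_nonneg_LHH h t
        case false.false.false.true.false.false.true.true.false => rw [C_swap23 h t]; exact C_nonneg_LLH h t
        case false.false.false.true.false.false.true.true.true => exact absurd v₃ (by decide)
        case false.false.false.true.false.true.false.false.false => exact C_nonneg_LLO h t
        case false.false.false.true.false.true.false.false.true => exact C_nonneg_LLH h t
        case false.false.false.true.false.true.false.true.false => exact C_nonneg_LLL h t
        case false.false.false.true.false.true.false.true.true => exact absurd v₃ (by decide)
        case false.false.false.true.false.true.true.false.false => exact absurd v₂ (by decide)
        case false.false.false.true.false.true.true.false.true => exact absurd v₂ (by decide)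
        case false.false.false.true.false.true.true.true.false => exact absurd v₂ (by decide)
        case false.false.false.true.false.true.true.true.true => exact absurd v₂ (by decide)
        case false.false.false.true.true.false.false.false.false => exact absurd v₁ (by decide)
        case false.false.false.true.true.false.false.false.true => exact absurd v₁ (by decide)
        case false.false.false.true.true.false.false.true.false => exact absurd v₁ (by decide)
        case false.false.false.true.true.false.false.true.true => exact absurd v₁ (by decide)
        case false.false.false.true.true.false.true.false.false => exact absurd v₁ (by decide)
        case false.false.false.true.true.false.true.false.true => exact absurd v₁ (by decide)
        case false.false.false.true.true.false.true.true.false => exact absurd v₁ (by decide)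
        case false.false.false.true.true.false.true.true.true => exact absurd v₁ (by decide)
        case false.false.false.true.true.true.false.false.false => exact absurd v₁ (by decide)
        case false.false.false.true.true.true.false.false.true => exact absurd v₁ (by decide)
        case false.false.false.true.true.true.false.true.false => exact absurd v₁ (by decide)
        case false.false.false.true.true.true.false.true.true => exact absurd v₁ (by decide)
        case false.false.false.true.true.true.true.false.false => exact absurd v₁ (by decide)
        case false.false.false.true.true.true.true.false.true => exact absurd v₁ (by decide)
        case false.false.false.true.true.true.true.true.false => exact absurd v₁ (by decide)
        case false.false.false.true.true.true.true.true.true => exact absurd v₁ (by decide)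
      · exact le_of_eq (C_eq_zero_of_J h t (Or.inr (Or.inr rfl))).symm
    · exact le_of_eq (C_eq_zero_of_J h t (Or.inr (Or.inl rfl))).symm
  · exact le_of_eq (C_eq_zero_of_J h t (Or.inl rfl)).symm

end Cert

end THub

end CovForm

end Summit.Ventures.PercRepro2
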